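import Literature.Computability.Complexity.SearchToDecision
import Literature.Computability.Complexity.OnesZeroPadding
import Literature.Computability.Complexity.CodeFPBudgets
import Literature.Computability.Complexity.CountingHierarchyProofs
import Literature.Computability.Complexity.NondeterministicProofs
import Literature.Computability.Complexity.CountingHierarchyInter
import HarnessLib

/-!
# Worst-case one-way functions exist iff `P ≠ NP`

Reproduction (statement **and complete proof**, over the tree's `TM2` model: `Classes.P`,
`Nondeterministic.NP`, `FP`) of the folklore characterisation of **complexity-theoretic
(worst-case) one-way functions**:

* J. Grollmann, A. L. Selman, *Complexity measures for public-key cryptosystems*, SIAM J. Comput.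
  **17** (1988) 309–335 (the worst-case notion; `P ≠ UP` iff one-to-one one-way functions exist);
* J. Rothe, *Complexity Theory and Cryptology* (Springer, 2005), **Prop. 8.35**: "There exist one-way
  functions if and only if `P ≠ NP`" (worst-case model of Def. 3.78: `f ∈ FP`, honest, not
  `FP`-invertible) [held: `book:rothend-complexity-theory-cryptology`, chunk p0489 (Prop. 8.35),
  p0161 (Def. 3.78), p0506 (history: Grollmann–Selman [GS88], Berman [Ber77], Ko [Ko85])];
* J. Talbot, D. Welsh, *Complexity and Cryptography* (CUP, 2006), §6.2–6.3: the convention that an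
  inverter receives `(f(x), 1ᵏ)` with `k = |x|` ("this guarantees that at least one preimage of
  `f(x)` can be written down in polynomial time", which replaces honesty), and **Thm. 6.6**: a
  (strong) one-way function gives a language in `NP ∖ P` [held:
  `book:talbot2006-complexity-cryptography-introduction`, p0101 (inversion with `1ᵏ`), p0103 (Thm. 6.6
  and its proof via `L_f`)].

The direction "`NP ⊆ P` ⇒ every `f ∈ FP` is invertible on inputs `⟨1ⁿ, f x⟩`" is already in the
tree as `exists_inverter_of_NP_subset_P` (`SearchToDecision.lean`, Goldreich's `L_f`). This file
adds the converse and the equivalences: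

* `NP_subset_P_of_forall_exists_inverter` — if EVERY `f ∈ FP` has an `FP` inverter `g`
  (`f (g ⟨1ⁿ, f x⟩) = f x` whenever `|x| = n`), then `NP ⊆ P`. Proof: for `L ∈ NP` with verifier
  `R ∈ P` and bound `p`, the **tagged verifier map** `f ⟨x, y'⟩ = ⟨x, [R'(x, y')]⟩` — where `R'`
  accepts exactly the front-padded witnesses `1ʲ0y` of the exact length `p(|x|) + 1` — is in `FP`;
  every accepting preimage of `⟨x, [1]⟩` has the same length `N(x) = 2|x| + 2 + p(|x|) + 1`, so
  `x ∈ L ↔ f (g ⟨1^{N(x)}, ⟨x, [1]⟩⟩) = ⟨x, [1]⟩`, a polynomial-time test.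
* `NP_subset_P_iff_forall_exists_inverter`, `not_NP_subset_P_iff_exists_oneWay` — `NP ⊆ P` iff
  every `FP` function is `FP`-invertible (with the unary length hint); equivalently `¬ NP ⊆ P` iff
  some `f ∈ FP` defeats every `FP` inverter on some input (a worst-case one-way function).

All functions are assembled from `CodeFP` bricks; no Turing machine is written.
-/

namespace Literature.Computability.Complexity

open _root_.Computability Polynomial CodeFP
open scoped Notation

/-- **Universal worst-case invertibility collapses `NP` to `P`.** If every polynomial-time
function `f` has a polynomial-time `g` with `f (g ⟨1ⁿ, f x⟩) = f x` for all `x` of length `n`,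
then `NP ⊆ P` (decide `x ∈ L` by asking `g` to invert the tagged verifier map at `⟨x, [1]⟩`).
[cite: RotheJ2005, Prop. 8.35 (one-way functions exist iff P ≠ NP; held book:rothend-complexity-theory-cryptology chunk p0489)]
[cite: TalbotWelsh2006, Thm. 6.6 and §6.2 (inverters receive (f(x), 1^k); held book:talbot2006-complexity-cryptography-introduction p0101, p0103)] -/
theorem NP_subset_P_of_forall_exists_inverter
    (h : ∀ f ∈ FP, ∃ g ∈ FP, ∀ (n : ℕ) (x : List Bool), x.length = n →
      f (g (boolPair (unaryEncodeNat n) (f x))) = f x) :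
    Nondeterministic.NP ⊆ Classes.P := by
  classical
  intro L hL
  obtain ⟨R, hR, p, hver⟩ := hL
  have hpolyU : ∀ P : Polynomial ℕ, CodeFP unE unE (fun n => P.eval n) := fun P =>
    ⟨Plumb.polyFn P, Plumb.polyFn_mem_FP P, fun n => by
      rw [Plumb.polyFn_apply, length_unE, unE_eq_ones]⟩
  /- Exact-length witnesses `1ʲ 0 y`, `|1ʲ0y| = p(|x|) + 1`. -/
  obtain ⟨RE, hRE⟩ : ∃ RE : List Bool → List Bool → Bool, RE = fun x y' =>
      (decide (y'.length = p.eval x.length + 1) &&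
        R.boolIndicator (boolPair x ((MWProtocol.stripOnes y').drop 1))) := ⟨_, rfl⟩
  have hRE1 : ∀ x y', RE x y' = true → x ∈ L := by
    intro x y' h
    rw [hRE] at h
    simp only [Bool.and_eq_true, decide_eq_true_eq] at h
    refine (hver x).2 ⟨_, ?_, (Set.mem_iff_boolIndicator _ _).2 h.2⟩
    rcases MWProtocol.eq_replicate_or_exists y' with ⟨hz, hs⟩ | ⟨a, x', hz, hs⟩
    · rw [hs]; simp
    · rw [hs]
      have := congrArg List.length hz
      simp only [List.length_append, List.length_replicate, List.length_cons] at this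
      simp only [List.drop_succ_cons, List.drop_zero]
      omega
  have hRE2 : ∀ x ∈ L, ∃ y', y'.length = p.eval x.length + 1 ∧ RE x y' = true := by
    intro x hx
    obtain ⟨y, hy, hyR⟩ := (hver x).1 hx
    refine ⟨OnesZeroPad.padTo (p.eval x.length + 1) y, OnesZeroPad.length_padTo (by omega), ?_⟩
    rw [hRE]
    simp only [Bool.and_eq_true, decide_eq_true_eq]
    refine ⟨OnesZeroPad.length_padTo (by omega), ?_⟩
    rw [OnesZeroPad.padTo, MWProtocol.stripOnes_replicate_append, List.drop_succ_cons, List.drop_zero]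
    exact (Set.mem_iff_boolIndicator _ _).1 hyR
  have hREC : CodeFP (pairE strE strE) bitE (fun t => RE t.1 t.2) := by
    have hpay : CodeFP strE strE (fun z => (MWProtocol.stripOnes z).drop 1) :=
      CodeFP.of_fn _ OnesZeroPad.payload_mem_FP fun _ => rfl
    have hRC : CodeFP strE bitE (fun z => R.boolIndicator z) :=
      ⟨fun z => encodeBool (R.boolIndicator z), indicatorFn_mem_FP hR, fun _ => rfl⟩
    have hm : CodeFP (pairE strE strE) unE (fun t => p.eval t.1.length + 1) :=
      (unSucc.comp ((hpolyU p).comp (strLength.comp (CodeFP.fst _ _))) :)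
    have hlen : CodeFP (pairE strE strE) bitE (fun t => decide (t.2.length = p.eval t.1.length + 1)) :=
      ((CodeFP.eq unE_injective).comp ((strLength.comp (CodeFP.snd _ _)).pair hm) :)
    have hXB : CodeFP (pairE strE strE) strE
        (fun t => boolPair t.1 ((MWProtocol.stripOnes t.2).drop 1)) :=
      ((CodeFP.fst _ _).pair (hpay.comp (CodeFP.snd _ _))).recodeOut fun _ => rfl
    rw [hRE]
    exact hlen.and (hRC.comp hXB)
  /- The tagged verifier map `f ⟨x, y'⟩ = ⟨x, [RE x y']⟩`. -/
  obtain ⟨f, hfdef⟩ : ∃ f : List Bool → List Bool, f = fun z =>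
      boolPair (boolUnpair z).1 (if RE (boolUnpair z).1 (boolUnpair z).2 then [true] else [false]) :=
    ⟨_, rfl⟩
  have h1 : CodeFP strE strE (fun z => (boolUnpair z).1) := ⟨_, boolUnpairFst_mem_FP, fun _ => rfl⟩
  have h2 : CodeFP strE strE (fun z => (boolUnpair z).2) := ⟨_, boolUnpairSnd_mem_FP, fun _ => rfl⟩
  have hfC : CodeFP strE strE f := by
    have hb : CodeFP strE bitE (fun z => RE (boolUnpair z).1 (boolUnpair z).2) :=
      (hREC.comp (h1.pair h2) :)
    have hs : CodeFP strE strE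
        (fun z => if RE (boolUnpair z).1 (boolUnpair z).2 then [true] else [false]) :=
      CodeFP.ite hb (CodeFP.const strE [true]) (CodeFP.const strE [false])
    rw [hfdef]
    exact (h1.pair hs).recodeOut fun _ => rfl
  have hfFP : f ∈ FP := by
    obtain ⟨d, hd, hdf⟩ := hfC
    have : d = f := funext fun a => hdf a
    exact this ▸ hd
  obtain ⟨g, hg, hginv⟩ := h f hfFP
  have hgC : CodeFP strE strE g := ⟨g, hg, fun _ => rfl⟩
  /- All accepting preimages of `⟨x, [1]⟩` have length `N x`. -/
  obtain ⟨N, hN⟩ : ∃ N : List Bool → ℕ, N = fun x => (2 * X + 3 + p).eval x.length := ⟨_, rfl⟩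
  have hNx : ∀ x y', y'.length = p.eval x.length + 1 → (boolPair x y').length = N x := by
    intro x y' hy'
    rw [length_boolPair, hN, hy']
    simp only [eval_add, eval_mul, eval_ofNat, eval_X]
    omega
  /- The decision procedure. -/
  obtain ⟨Dec, hDec⟩ : ∃ Dec : List Bool → Bool, Dec = fun x =>
      decide (f (g (boolPair (unaryEncodeNat (N x)) (boolPair x [true]))) = boolPair x [true]) := ⟨_, rfl⟩
  have hfval : ∀ w x, f w = boolPair x [true] → x ∈ L := by
    intro w x hw
    rw [hfdef] at hw
    have hpair := congrArg boolUnpair hw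
    rw [boolUnpair_boolPair, boolUnpair_boolPair] at hpair
    have hx : (boolUnpair w).1 = x := congrArg Prod.fst hpair
    have htag : (if RE (boolUnpair w).1 (boolUnpair w).2 then [true] else [false]) = [true] :=
      congrArg Prod.snd hpair
    cases hRw : RE (boolUnpair w).1 (boolUnpair w).2 with
    | false => rw [hRw] at htag; simp at htag
    | true => exact hx ▸ hRE1 _ _ hRw
  have hDec1 : ∀ x ∈ L, Dec x = true := by
    intro x hx
    obtain ⟨y', hy', hRy⟩ := hRE2 x hx
    have hz : f (boolPair x y') = boolPair x [true] := by
      rw [hfdef]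
      simp only [boolUnpair_boolPair, hRy]
      rfl
    have := hginv (N x) (boolPair x y') (hNx x y' hy')
    rw [hz] at this
    rw [hDec]
    exact decide_eq_true this
  have hDec2 : ∀ x, Dec x = true → x ∈ L := by
    intro x hx
    rw [hDec] at hx
    exact hfval _ x (of_decide_eq_true hx)
  have hDecC : CodeFP strE bitE Dec := by
    have hNC : CodeFP strE unE (fun x => N x) := by
      rw [hN]
      exact ((hpolyU (2 * X + 3 + p)).comp strLength :)
    have hc : CodeFP strE strE (fun _ => [true]) := CodeFP.const strE [true]
    have hT : CodeFP strE strE (fun x => boolPair x [true]) :=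
      ((CodeFP.id strE).pair hc).recodeOut fun _ => rfl
    have hQ : CodeFP strE strE (fun x => boolPair (unaryEncodeNat (N x)) (boolPair x [true])) :=
      (hNC.pair hT).recodeOut fun _ => rfl
    rw [hDec]
    exact ((CodeFP.eq (eα := strE) Function.injective_id).comp ((hfC.comp (hgC.comp hQ)).pair hT) :)
  obtain ⟨d, hd, hdx⟩ := hDecC
  refine mem_P_of_mem_FP hd _ fun x => ⟨fun hx => ?_, fun hx => ?_⟩
  · have := hdx x
    rw [hDec1 x hx] at this
    exact this
  · have := hdx x
    cases hDx : Dec x with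
    | true => exact absurd (hDec2 x hDx) hx
    | false => rw [hDx] at this; exact this

/-- **`NP ⊆ P` iff every polynomial-time function is polynomial-time invertible** (inverters
receive the unary length of a preimage). [cite: RotheJ2005, Prop. 8.35 (held book:rothend-complexity-theory-cryptology chunk p0489)]
[cite: Goldreich2001, §2.7.4 Exercise 2 (the direction NP ⊆ P ⇒ inverters, `exists_inverter_of_NP_subset_P`)] -/
theorem NP_subset_P_iff_forall_exists_inverter :
    Nondeterministic.NP ⊆ Classes.P ↔
      ∀ f ∈ FP, ∃ g ∈ FP, ∀ (n : ℕ) (x : List Bool), x.length = n →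
        f (g (boolPair (unaryEncodeNat n) (f x))) = f x := by
  refine ⟨fun h f hf => ?_, NP_subset_P_of_forall_exists_inverter⟩
  obtain ⟨g, hg, hspec⟩ := exists_inverter_of_NP_subset_P h hf
  exact ⟨g, hg, fun n x hx => (hspec n x hx).2⟩

/-- **Worst-case one-way functions exist iff `NP ⊄ P`.** Some `f ∈ FP` such that every `g ∈ FP`
fails to invert `f` on some `⟨1ⁿ, f x⟩`, `|x| = n`, exists iff `NP ⊄ P`.
[cite: RotheJ2005, Prop. 8.35 (held book:rothend-complexity-theory-cryptology chunk p0489)]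
[cite: GrollmannSelman1988, §3 (worst-case one-way functions; theorem number not verified: source not held)] -/
theorem not_NP_subset_P_iff_exists_oneWay :
    ¬ Nondeterministic.NP ⊆ Classes.P ↔
      ∃ f ∈ FP, ∀ g ∈ FP, ∃ (n : ℕ) (x : List Bool), x.length = n ∧
        f (g (boolPair (unaryEncodeNat n) (f x))) ≠ f x := by
  rw [NP_subset_P_iff_forall_exists_inverter]
  constructor
  · intro h
    by_contra hne
    refine h fun f hf => ?_
    by_contra hg
    refine hne ⟨f, hf, fun g hg' => ?_⟩
    by_contra hx
    refine hg ⟨g, hg', fun n x hxn => ?_⟩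
    by_contra hfx
    exact hx ⟨n, x, hxn, hfx⟩
  · rintro ⟨f, hf, hno⟩ hall
    obtain ⟨g, hg, hinv⟩ := hall f hf
    obtain ⟨n, x, hxn, hne⟩ := hno g hg
    exact hne (hinv n x hxn)

end Literature.Computability.Complexity
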